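import Mathlib.ModelTheory.Ultraproducts
import Mathlib.Order.Filter.Ultrafilter.Basic
import Literature.ModelTheory.PseudofiniteFields.FiniteFieldTheory

/-!
# Uniform bounds over pseudo-finite fields (compactness, via Łoś's theorem)

Let `χ₀, χ₁, χ₂, …` be formulas of the language of rings in free variables `α`. If in every
pseudo-finite field `K` — an infinite field satisfying every sentence true in all finite fields,
`K ⊨ finiteFieldTheory` [ChatzidakisVanDenDriesMacintyre1992, p. 110] — every tuple `v : α → K`
satisfies *some* `χ_N`, then one `N` works uniformly: every tuple of every pseudo-finite field
satisfies some `χ_n` with `n ≤ N` (`FiniteField.exists_uniform_bound_of_pseudoFinite`).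

This is the routine compactness step turning "in every pseudo-finite field there is a bound"
into "there is a bound depending only on the formulas" (used tacitly throughout
[ChatzidakisVanDenDriesMacintyre1992], e.g. around Prop. (2.7)).

Proof (ultraproducts). If no `N` works, pick for each `N` a pseudo-finite field `K_N` and a
tuple `v_N` falsifying `χ_0, …, χ_N`. The ultraproduct `M = ∏_u K_N` along a non-principal
ultrafilter `u` on `ℕ` is again an infinite model of `finiteFieldTheory` (Łoś), hence — made
into a field by Mathlib's `fieldOfModelField` — a pseudo-finite field; so the tuple `(v_N)_u`
satisfies some `χ_{N₀}` in `M`, hence (Łoś for formulas with parameters) `v_N` satisfies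
`χ_{N₀}` in `K_N` for `u`-almost all `N`, in particular for some `N ≥ N₀` — a contradiction
(`FiniteField.exists_le_realize_seq`).

No monotonicity of `χ_N` in `N` is assumed (accordingly the conclusion reads `∃ n ≤ N, χ_n`),
and the variable type `α` is arbitrary.

## References

* [ChatzidakisVanDenDriesMacintyre1992] Z. Chatzidakis, L. van den Dries, A. Macintyre,
  Definable sets over finite fields, J. reine angew. Math. 427 (1992) 107–135, p. 110, (2.7).
-/

namespace Literature.ModelTheory.PseudofiniteFields

open FirstOrder FirstOrder.Language FirstOrder.Ring FirstOrder.Field Filter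
open scoped FirstOrder

/-- An ultraproduct of models of a theory `T` is a model of `T` (Łoś's theorem, sentence by
sentence). [folklore] -/
theorem model_ultraproduct_of_forall_model {L : Language} {ι : Type*} {u : Ultrafilter ι}
    {K : ι → Type*} [∀ i, L.Structure (K i)] [∀ i, Nonempty (K i)] {T : L.Theory}
    (hK : ∀ i, K i ⊨ T) : (u : Filter ι).Product K ⊨ T :=
  ⟨fun σ hσ => (Ultraproduct.sentence_realize σ).2
    (Eventually.of_forall fun i => (hK i).realize_of_mem σ hσ)⟩

namespace FiniteField

/-- A property assumed of all tuples of all pseudo-finite *fields*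
(`[Field K] [CompatibleRing K] [Infinite K]`, `K ⊨ finiteFieldTheory`) holds of all tuples of
every infinite `Language.ring`-*structure* that is a model of `finiteFieldTheory`: such a
structure satisfies the field axioms, and Mathlib's `fieldOfModelField` /
`compatibleRingOfModelField` make it a field with the given ring structure. (Instance
bookkeeping only.) [folklore] -/
theorem exists_realize_of_model_finiteFieldTheory {α : Type}
    (χ : ℕ → Language.ring.Formula α)
    (h : ∀ (K : Type) [Field K] [CompatibleRing K] [Infinite K], K ⊨ finiteFieldTheory →
      ∀ v : α → K, ∃ N, (χ N).Realize v)
    (M : Type) [Language.ring.Structure M] [Infinite M] (hM : M ⊨ finiteFieldTheory)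
    (x : α → M) : ∃ N, (χ N).Realize x := by
  haveI : M ⊨ FirstOrder.Language.Theory.field := hM.mono field_subset_finiteFieldTheory
  letI : Field M := fieldOfModelField M
  letI : CompatibleRing M := compatibleRingOfModelField M
  exact h M hM x

/-- **The ultraproduct step.** If every tuple of every pseudo-finite field satisfies some
`χ_N`, then for ANY sequence of infinite models `K_N ⊨ finiteFieldTheory` (`N ∈ ℕ`) with
tuples `v_N : α → K_N`, some `v_N` satisfies some `χ_{N₀}` with `N₀ ≤ N`. Proof: the diagonal
tuple of the ultraproduct `∏_u K_N` (`u` non-principal) satisfies some `χ_{N₀}`; by Łoś so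
does `v_N` for `u`-almost all `N`, and `{N | N₀ ≤ N} ∈ u`. [folklore] -/
theorem exists_le_realize_seq {α : Type} (χ : ℕ → Language.ring.Formula α)
    (h : ∀ (K : Type) [Field K] [CompatibleRing K] [Infinite K], K ⊨ finiteFieldTheory →
      ∀ v : α → K, ∃ N, (χ N).Realize v)
    (K : ℕ → Type) [∀ N, Language.ring.Structure (K N)] [∀ N, Infinite (K N)]
    (hK : ∀ N, K N ⊨ finiteFieldTheory) (v : ∀ N, α → K N) :
    ∃ N₀ N, N₀ ≤ N ∧ (χ N₀).Realize (v N) := by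
  -- the ultraproduct along the non-principal ultrafilter `hyperfilter ℕ` is pseudo-finite
  have hM : ((hyperfilter ℕ : Ultrafilter ℕ) : Filter ℕ).Product K ⊨ finiteFieldTheory :=
    model_ultraproduct_of_forall_model hK
  have hMinf : ((hyperfilter ℕ : Ultrafilter ℕ) : Filter ℕ).Product K ⊨
      Language.ring.infiniteTheory :=
    model_ultraproduct_of_forall_model fun N => Language.ring.model_infiniteTheory
  haveI : Infinite (((hyperfilter ℕ : Ultrafilter ℕ) : Filter ℕ).Product K) :=
    (model_infiniteTheory_iff Language.ring).1 hMinf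
  -- so its diagonal tuple `(v_N)_u` satisfies some `χ_{N₀}` ...
  obtain ⟨N₀, hN₀⟩ := exists_realize_of_model_finiteFieldTheory χ h _ hM fun a =>
    ((fun N => v N a : ∀ N, K N) : ((hyperfilter ℕ : Ultrafilter ℕ) : Filter ℕ).Product K)
  -- ... hence (Łoś) `v_N` satisfies `χ_{N₀}` in `K_N` for almost all `N`, in particular for
  -- some `N ≥ N₀`
  have hlos : ∀ᶠ N in ((hyperfilter ℕ : Ultrafilter ℕ) : Filter ℕ), (χ N₀).Realize (v N) :=
    (Ultraproduct.realize_formula_cast (χ N₀) (fun a N => v N a)).1 hN₀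
  have hge : ∀ᶠ N in ((hyperfilter ℕ : Ultrafilter ℕ) : Filter ℕ), N₀ ≤ N :=
    Nat.hyperfilter_le_atTop (eventually_ge_atTop N₀)
  obtain ⟨N, hN₀N, hN⟩ := (hge.and hlos).exists
  exact ⟨N₀, N, hN₀N, hN⟩

/-- **Uniform bounds over pseudo-finite fields.** If `χ_N` (`N ∈ ℕ`) are ring formulas in the
free variables `α` and in every pseudo-finite field `K` every tuple `v : α → K` satisfies some
`χ_N`, then there is one `N` such that every tuple of every pseudo-finite field satisfies some
`χ_n` with `n ≤ N`. [folklore] compactness: a first-order bound that is finite at every tuple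
of every pseudo-finite field is uniform (proved through the ultraproduct `∏_u K_N` of
counterexamples and Łoś's theorem, `exists_le_realize_seq`). -/
theorem exists_uniform_bound_of_pseudoFinite {α : Type} (χ : ℕ → Language.ring.Formula α)
    (h : ∀ (K : Type) [Field K] [CompatibleRing K] [Infinite K], K ⊨ finiteFieldTheory →
      ∀ v : α → K, ∃ N, (χ N).Realize v) :
    ∃ N, ∀ (K : Type) [Field K] [CompatibleRing K] [Infinite K], K ⊨ finiteFieldTheory →
      ∀ v : α → K, ∃ n ≤ N, (χ n).Realize v := by
  by_contra hcon
  push Not at hcon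
  -- for each `N` a pseudo-finite field `K_N` and a tuple `v_N` falsifying `χ_0, …, χ_N`
  choose K instF instCR instI hK v hv using hcon
  obtain ⟨N₀, N, hN₀N, hN⟩ := exists_le_realize_seq χ h K hK v
  exact hv N N₀ hN₀N hN

end FiniteField

end Literature.ModelTheory.PseudofiniteFields
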